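/-
Origin: expansion seat `planner-pub-hodgecm-mc-axioms-1-g14-0`, handover #W169 2026-08-20T15:53:55Z md5 7068dd5c8138 (PKG ae5bd59a972e → 7068dd5c8138; 149 l.; MECHANICAL (iib-R) rewrite v3.1 of the PKG file as it stands (49 token edits; rules R1x2+RX[h₂]x47)) (`HOME/mc/pub-hodgecm-mc-axioms-1-g14/revendor/kit-r55/stage55/HodgeCM/Model/HypCensus/KappaJoinMu.lean`, md5 7068dd5c8138, 149 lines);
landed by the gen-22 packager (p-g22) in gate run 55 REPLACES the earlier landed copy of `HodgeCM/Model/HypCensus/KappaJoinMu.lean` (seat copy carried the packager Origin header of an earlier run (stripped)).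
-/
/-
Origin: speedrun cell pub-hodgecm, MODEL-CONSTRUCTION sub-cell, lineage mc-binder-2 (BINDER-OWNERS rows 18/19: E binders
`hyp12`/`hyp34`), seat `prover-pub-hodgecm-mc-binder-2-g14-0`, gen 14; (T12)/(B1′) second table (RULING S5b); private mirror certified.
-/
import Summits.HodgeConjecture.HodgeCM.Model.HypCensus.KappaJoin
import Summits.HodgeConjecture.HodgeCM.Model.HypCensus.OmgInsAll
import Summits.HodgeConjecture.HodgeCM.Model.ArchPinWeightDischarge

/-!
# Row 18 at the R1 pin MODULO THE (J-μ) SCALAR IDENTITY ONLY — and, at E's pin, modulo NOTHING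

The junction hypothesis `homg` of #78 `hyp12_of_census_R1At` (`HypCensus/KappaJoin` §3) is DISCHARGED by the `∀ φ` junction
theorem N3 `omgW_ins_eq_of_weight` (torus `jT₁₂`, census `datumAt`; RUN 50), leaving as the ONLY named residual of row 18 the (J-μ)
scalar identity `hμ` of #39 — which theta-3's (K13) `ArchSideTerm.hμ_GOG` (RUN 50) proves at E's pin of record for ANY census datum:

* **`hyp12_of_census_R1At_of_hμ (hc) (hK) (hcan) (jD) (hμ)`** — row 18 at the R1 pin from the data `jD` and
  `hμ : ∀ hW t, η(1,(diag u_t)_𝔸) · χ_T(u_t) · dIotaAt(u_t) = (w t)⁻¹` (`u_t = archOf … t`), for any Stage-B `χW`, side family `S`, exponents `μ`;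
* **`hyp12_of_census_R1At_GOG (hc) (hK) (hcan) (jD)`** — at E's pin of record (`χW := SInstance.χWR … (μ♯♯)`, `μ♯♯ := muSharp₂₃ μ`, glue-1's
  #398-lineage instantiation): (K13) plugged in, NO named residual — E's binder `hyp12` at one good canonical context is a THEOREM of the
  constructed pin ((V-val) #78 · (J-dense) #70 · (J-T12) N3 · (J-μ) (K13)); the (34) twin waits for the (B1′) census (RULING S5b) and (K14).

No `Prop`-valued definitions; no records; the W family, pin and context hypotheses are those of #78 verbatim.
-/

noncomputable section

open scoped TensorProduct InnerProductSpace Matrix Topology Classical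
open Filter
open NumberField NumberField.InfinitePlace

namespace HodgeCM.Model.HypCensus

open HodgeCM HodgeCM.Model HodgeCM.Universe HodgeCM.Adelic
open HodgeCM.Universe (AdelicThetaCore AdelicThetaCore₀ SideData ThetaModel)
open HodgeCM.PerL34 HodgeCM.PerL34.ArchC HodgeCM.PerL34.Fock HodgeCM.PerL34.Fock.PrintDict
open HodgeCM.Model.ArchSideTerm (e₁ posIdxEquivUnit negIdxEquivEmpty lambdaExponent dW' dW'_real dW'_ne)
open Literature.AlgebraicGeometry.HodgeTheory
open Literature.NumberTheory.Automorphic.PicardCM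
open Literature.NumberTheory.Transcendental (Arapura2012_Cor_15_4_6)
open Literature.NumberTheory.Automorphic (piSchwartzBruhat FinSB)
open Literature.NumberTheory.Automorphic.UnitaryGroup
open Literature.NumberTheory.Weil1964 (repWeilThetaDatum PosIdx NegIdx)
open Literature.NumberTheory.GelbartRogawski1991 Literature.NumberTheory.GelbartRogawski1991.UnitaryDualPair
open Literature.RepresentationTheory.CompactGroups (UnitaryGroupChar.diagU UnitaryGroupChar.coe_diagU)
open NumberField.SeesawArchTorus

/-! ## Row 18 at the R1 pin from (J-μ) -/

section R1

variable (hHD : exists_isReal_hodgeModel) (hI : hodgePQ_independent_of_hodgeModel)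
  (h₁ : BallQuotientUniformised)  (h₃ : CMAbelianVarietyRealised)
variable (hA : Arapura2012_Cor_15_4_6)
variable
  (hGR : ∀ {L : CMField} {ι₁ : L →+* ℂ} (V : HermSpace3 L ι₁) (c : SeesawCtx L),
    (cmSplittingDatum (L : Type) finProdFinEquiv (frameD V) (frameD_real V) (frameD_ne V) (dW c.D) (dW_real c.D) (dW_ne c.D)).CompatibleSplitting)
  (hGR₀ : ∀ {L : CMField} {ι₁ : L →+* ℂ} (V : HermSpace3 L ι₁) (c : SeesawCtx L),
    (cmSplittingDatum (L : Type) (e₁) (frameD V) (frameD_real V) (frameD_ne V) (lineVec (L : Type) (dW c.D 0))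
      (fun _ => dW_real c.D 0) (fun _ => dW_ne c.D 0)).CompatibleSplitting)
  (hGR₁ : ∀ {L : CMField} {ι₁ : L →+* ℂ} (V : HermSpace3 L ι₁) (c : SeesawCtx L),
    (cmSplittingDatum (L : Type) (e₁) (frameD V) (frameD_real V) (frameD_ne V) (lineVec (L : Type) (dW c.D 1))
      (fun _ => dW_real c.D 1) (fun _ => dW_ne c.D 1)).CompatibleSplitting)
  (χW : ∀ {L : CMField} {ι₁ : L →+* ℂ} (_V : HermSpace3 L ι₁) (_c : SeesawCtx L),
    ContinuousMonoidHom (Literature.NumberTheory.Automorphic.relNormOneIdeles (maximalRealSubfield (L : Type)) (L : Type) ⧸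
      Literature.NumberTheory.Automorphic.relNormOneRat (maximalRealSubfield (L : Type)) (L : Type)) Circle)
  (S : ∀ {L : CMField} {ι₁ : L →+* ℂ} (V : HermSpace3 L ι₁) (c : SeesawCtx L), ThetaAdelicSide V c)
  (μ : ∀ {L : CMField}, SeesawCtx L → Fin 4 → InfinitePlace L → ℤ)
variable {L : CMField} {ι₁ : L →+* ℂ} (V : HermSpace3 L ι₁) (c : SeesawCtx L)

/-- **ROW 18 (`hyp12`) AT THE R1 PIN MODULO (J-μ) ONLY**: #78 `hyp12_of_census_R1At` with its junction `homg` supplied by N3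
`omgW_ins_eq_of_weight` from the scalar identity `hμ` (census `datumAt`, torus `jT₁₂`, exponents `(−μ₀, −μ₁)`). -/
theorem hyp12_of_census_R1At_of_hμ
    (hc : (thetaModelOf hHD hI h₁ h₃ (orientBitι L ι₁) (_root_.HodgeCM.Model.embOf hHD hI h₁ h₃) (coverOf hHD hI h₁ h₃ hA) (wmOfInput (Wcm hGR (EtaChi.η (@SInstance.χVR @hGR @hGR₀ @hGR₁) @χW) (EtaChi.hη (@SInstance.χVR @hGR @hGR₀ @hGR₁) @χW) (EtaChi.hηc (@SInstance.χVR @hGR @hGR₀ @hGR₁) @χW))) (thetaOf _ (thetaClassInputOf _ (fun V c => thetaSpaceInputOf hHD hI h₁ h₃ S V c))) (d12Of μ) (d34Of μ)).GoodCtx ι₁ c)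
    (hK : Module.finrank ℚ c.K = 6) (hcan : (InfinitePlace.mk ι₁).embedding = ι₁)
    (jD : InfinitePlace (L : Type) → EqVar → Fin 6)
    (hμ : ∀ (hW : (∀ j, 0 < (ι₁ ((dW c.D) j)).re) ∨ ∀ j, (ι₁ ((dW c.D) j)).re < 0)
      (t : (placesAt V c.D hW jD (fun w => -μ c 0 w) (fun w => -μ c 1 w)).Tg),
      muScalar V c.D (hGR V c) (EtaChi.η (@SInstance.χVR @hGR @hGR₀ @hGR₁) @χW V c) hW jD (fun w => -μ c 0 w) (fun w => -μ c 1 w) t *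
          dIotaAt (L : Type) (frameD V) (dW c.D) (dW_real c.D) ι₁ (archOf V c.D (datumAt V c.D jD (jIOf V c.D hW)) (fun w => -μ c 0 w) (fun w => -μ c 1 w) t) =
        (printPlacesW (InfinitePlace (L : Type))
          (kindOf (L : Type) (frameD V) (frameD_real V) (dW c.D) (dW_real c.D) ι₁ (datumAt V c.D jD (jIOf V c.D hW)))
          (lamOf (L : Type) (frameD V) (frameD_real V) (dW c.D) (dW_real c.D) ι₁ (datumAt V c.D jD (jIOf V c.D hW)))
          (lamOf_ne_zero (L : Type) (frameD V) (frameD_real V) (dW c.D) (dW_real c.D) ι₁ (datumAt V c.D jD (jIOf V c.D hW)))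
          (pinnedVacs (kindOf (L : Type) (frameD V) (frameD_real V) (dW c.D) (dW_real c.D) ι₁ (datumAt V c.D jD (jIOf V c.D hW))) (fun w => -μ c 0 w) (fun w => -μ c 1 w)) t)⁻¹) :
    Nonempty (((coreOf _ (_root_.HodgeCM.Model.embOf hHD hI h₁ h₃) (coverOf hHD hI h₁ h₃ hA) (wmOfInput (Wcm hGR (EtaChi.η (@SInstance.χVR @hGR @hGR₀ @hGR₁) @χW) (EtaChi.hη (@SInstance.χVR @hGR @hGR₀ @hGR₁) @χW) (EtaChi.hηc (@SInstance.χVR @hGR @hGR₀ @hGR₁) @χW))) (thetaOf _ (thetaClassInputOf _ (fun V c => thetaSpaceInputOf hHD hI h₁ h₃ S V c)))).toCore (orientBitι L ι₁)).HypSmoothCore12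
      (((coreOf _ (_root_.HodgeCM.Model.embOf hHD hI h₁ h₃) (coverOf hHD hI h₁ h₃ hA) (wmOfInput (Wcm hGR (EtaChi.η (@SInstance.χVR @hGR @hGR₀ @hGR₁) @χW) (EtaChi.hη (@SInstance.χVR @hGR @hGR₀ @hGR₁) @χW) (EtaChi.hηc (@SInstance.χVR @hGR @hGR₀ @hGR₁) @χW))) (thetaOf _ (thetaClassInputOf _ (fun V c => thetaSpaceInputOf hHD hI h₁ h₃ S V c)))).toCore (orientBitι L ι₁)).side12 (d12Of μ)) (((coreOf _ (_root_.HodgeCM.Model.embOf hHD hI h₁ h₃) (coverOf hHD hI h₁ h₃ hA) (wmOfInput (Wcm hGR (EtaChi.η (@SInstance.χVR @hGR @hGR₀ @hGR₁) @χW) (EtaChi.hη (@SInstance.χVR @hGR @hGR₀ @hGR₁) @χW) (EtaChi.hηc (@SInstance.χVR @hGR @hGR₀ @hGR₁) @χW))) (thetaOf _ (thetaClassInputOf _ (fun V c => thetaSpaceInputOf hHD hI h₁ h₃ S V c)))).toCore (orientBitι L ι₁)).side34 (d34Of μ))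
      ((((coreOf _ (_root_.HodgeCM.Model.embOf hHD hI h₁ h₃) (coverOf hHD hI h₁ h₃ hA) (wmOfInput (Wcm hGR (EtaChi.η (@SInstance.χVR @hGR @hGR₀ @hGR₁) @χW) (EtaChi.hη (@SInstance.χVR @hGR @hGR₀ @hGR₁) @χW) (EtaChi.hηc (@SInstance.χVR @hGR @hGR₀ @hGR₁) @χW))) (thetaOf _ (thetaClassInputOf _ (fun V c => thetaSpaceInputOf hHD hI h₁ h₃ S V c)))).toCore (orientBitι L ι₁)).analyticKM (((coreOf _ (_root_.HodgeCM.Model.embOf hHD hI h₁ h₃) (coverOf hHD hI h₁ h₃ hA) (wmOfInput (Wcm hGR (EtaChi.η (@SInstance.χVR @hGR @hGR₀ @hGR₁) @χW) (EtaChi.hη (@SInstance.χVR @hGR @hGR₀ @hGR₁) @χW) (EtaChi.hηc (@SInstance.χVR @hGR @hGR₀ @hGR₁) @χW))) (thetaOf _ (thetaClassInputOf _ (fun V c => thetaSpaceInputOf hHD hI h₁ h₃ S V c)))).toCore (orientBitι L ι₁)).side12 (d12Of μ))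
        (((coreOf _ (_root_.HodgeCM.Model.embOf hHD hI h₁ h₃) (coverOf hHD hI h₁ h₃ hA) (wmOfInput (Wcm hGR (EtaChi.η (@SInstance.χVR @hGR @hGR₀ @hGR₁) @χW) (EtaChi.hη (@SInstance.χVR @hGR @hGR₀ @hGR₁) @χW) (EtaChi.hηc (@SInstance.χVR @hGR @hGR₀ @hGR₁) @χW))) (thetaOf _ (thetaClassInputOf _ (fun V c => thetaSpaceInputOf hHD hI h₁ h₃ S V c)))).toCore (orientBitι L ι₁)).side34 (d34Of μ))).toAnalytic) V c (ℓ := linOfInput (Wcm hGR (EtaChi.η (@SInstance.χVR @hGR @hGR₀ @hGR₁) @χW) (EtaChi.hη (@SInstance.χVR @hGR @hGR₀ @hGR₁) @χW) (EtaChi.hηc (@SInstance.χVR @hGR @hGR₀ @hGR₁) @χW)) V c)) :=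
  hyp12_of_census_R1At hHD hI h₁ h₃ hA hGR hGR₀ hGR₁ χW S μ V c hc hK hcan jD fun hW f t φ =>
    omgW_ins_eq_of_weight V c.D (hGR V c) (EtaChi.η (@SInstance.χVR @hGR @hGR₀ @hGR₁) @χW V c) (EtaChi.hη (@SInstance.χVR @hGR @hGR₀ @hGR₁) @χW V c) (EtaChi.hηc (@SInstance.χVR @hGR @hGR₀ @hGR₁) @χW V c)
      ι₁ V.sylvesterFrame (sylvesterFrame_formCongr V) hW jD (fun w => -μ c 0 w) (fun w => -μ c 1 w) (hμ hW) f t φ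

end R1


/-! ## Row 18 at E's pin of record: NO named residual (theta-3's (K13) `hμ_GOG` plugged in) -/

section GOG

variable (hHD : exists_isReal_hodgeModel) (hI : hodgePQ_independent_of_hodgeModel)
  (h₁ : BallQuotientUniformised)  (h₃ : CMAbelianVarietyRealised)
variable (hA : Arapura2012_Cor_15_4_6)
variable
  (hGR : ∀ {L : CMField} {ι₁ : L →+* ℂ} (V : HermSpace3 L ι₁) (c : SeesawCtx L),
    (cmSplittingDatum (L : Type) finProdFinEquiv (frameD V) (frameD_real V) (frameD_ne V) (dW c.D) (dW_real c.D) (dW_ne c.D)).CompatibleSplitting)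
  (hGR₀ : ∀ {L : CMField} {ι₁ : L →+* ℂ} (V : HermSpace3 L ι₁) (c : SeesawCtx L),
    (cmSplittingDatum (L : Type) (e₁) (frameD V) (frameD_real V) (frameD_ne V) (lineVec (L : Type) (dW c.D 0))
      (fun _ => dW_real c.D 0) (fun _ => dW_ne c.D 0)).CompatibleSplitting)
  (hGR₁ : ∀ {L : CMField} {ι₁ : L →+* ℂ} (V : HermSpace3 L ι₁) (c : SeesawCtx L),
    (cmSplittingDatum (L : Type) (e₁) (frameD V) (frameD_real V) (frameD_ne V) (lineVec (L : Type) (dW c.D 1))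
      (fun _ => dW_real c.D 1) (fun _ => dW_ne c.D 1)).CompatibleSplitting)
  (hGR₂ : ∀ {L : CMField} {ι₁ : L →+* ℂ} (V : HermSpace3 L ι₁) (c : SeesawCtx L),
    (cmSplittingDatum (L : Type) (e₁) (frameD V) (frameD_real V) (frameD_ne V) (lineVec (L : Type) (dW' c.D 0))
      (fun _ => dW'_real c.D 0) (fun _ => dW'_ne c.D 0)).CompatibleSplitting)
  (hGR₃ : ∀ {L : CMField} {ι₁ : L →+* ℂ} (V : HermSpace3 L ι₁) (c : SeesawCtx L),
    (cmSplittingDatum (L : Type) (e₁) (frameD V) (frameD_real V) (frameD_ne V) (lineVec (L : Type) (dW' c.D 1))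
      (fun _ => dW'_real c.D 1) (fun _ => dW'_ne c.D 1)).CompatibleSplitting)
  (S : ∀ {L : CMField} {ι₁ : L →+* ℂ} (V : HermSpace3 L ι₁) (c : SeesawCtx L), ThetaAdelicSide V c)
  (μ : ∀ {L : CMField}, SeesawCtx L → Fin 4 → InfinitePlace L → ℤ)
variable {L : CMField} {ι₁ : L →+* ℂ} (V : HermSpace3 L ι₁) (c : SeesawCtx L)

include hGR₂ hGR₃ in
/-- **ROW 18 (`hyp12`) AT E's PIN OF RECORD WITH NO NAMED RESIDUAL**: `hyp12_of_census_R1At_of_hμ` at the Stage-B character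
`χW := SInstance.χWR … (μ♯♯)`, exponents `μ♯♯ := muSharp₂₃ μ` (glue-1's #398-lineage instantiation of #78), its (J-μ) identity supplied by
theta-3's (K13) `ArchSideTerm.hμ_GOG` (OG guard `⟨hcan, hc'⟩`); the census datum `jD` and the side family `S` stay free.  This is E's
row-18 binder at one good canonical context as a THEOREM of the constructed pin: (V-val) #78, (J-dense) #70, (J-T12) N3 + (K13). -/
theorem hyp12_of_census_R1At_GOG
    (hc : (thetaModelOf hHD hI h₁ h₃ (orientBitι L ι₁) (_root_.HodgeCM.Model.embOf hHD hI h₁ h₃) (coverOf hHD hI h₁ h₃ hA) (wmOfInput (Wcm hGR (EtaChi.η (@SInstance.χVR @hGR @hGR₀ @hGR₁) (@SInstance.χWR @hGR @hGR₀ @hGR₁ (ArchSideTerm.muSharp₂₃ @μ))) (EtaChi.hη (@SInstance.χVR @hGR @hGR₀ @hGR₁) (@SInstance.χWR @hGR @hGR₀ @hGR₁ (ArchSideTerm.muSharp₂₃ @μ))) (EtaChi.hηc (@SInstance.χVR @hGR @hGR₀ @hGR₁) (@SInstance.χWR @hGR @hGR₀ @hGR₁ (ArchSideTerm.muSharp₂₃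 @μ))))) (thetaOf _ (thetaClassInputOf _ (fun V c => thetaSpaceInputOf hHD hI h₁ h₃ S V c))) (d12Of (ArchSideTerm.muSharp₂₃ @μ)) (d34Of (ArchSideTerm.muSharp₂₃ @μ))).GoodCtx ι₁ c)
    (hK : Module.finrank ℚ c.K = 6) (hcan : (InfinitePlace.mk ι₁).embedding = ι₁)
    (jD : InfinitePlace (L : Type) → EqVar → Fin 6) :
    Nonempty (((coreOf _ (_root_.HodgeCM.Model.embOf hHD hI h₁ h₃) (coverOf hHD hI h₁ h₃ hA) (wmOfInput (Wcm hGR (EtaChi.η (@SInstance.χVR @hGR @hGR₀ @hGR₁) (@SInstance.χWR @hGR @hGR₀ @hGR₁ (ArchSideTerm.muSharp₂₃ @μ))) (EtaChi.hη (@SInstance.χVR @hGR @hGR₀ @hGR₁) (@SInstance.χWR @hGR @hGR₀ @hGR₁ (ArchSideTerm.muSharp₂₃ @μ))) (EtaChi.hηc (@SInstance.χVR @hGR @hGR₀ @hGR₁) (@SInstance.χWR @hGR @hGR₀ @hGR₁ (ArchSideTerm.muSharp₂₃ @μ))))) (thetaOf _ (thetaClassInputOf _ (fun V c => thetaSpaceInputOf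 hHD hI h₁ h₃ S V c)))).toCore (orientBitι L ι₁)).HypSmoothCore12
      (((coreOf _ (_root_.HodgeCM.Model.embOf hHD hI h₁ h₃) (coverOf hHD hI h₁ h₃ hA) (wmOfInput (Wcm hGR (EtaChi.η (@SInstance.χVR @hGR @hGR₀ @hGR₁) (@SInstance.χWR @hGR @hGR₀ @hGR₁ (ArchSideTerm.muSharp₂₃ @μ))) (EtaChi.hη (@SInstance.χVR @hGR @hGR₀ @hGR₁) (@SInstance.χWR @hGR @hGR₀ @hGR₁ (ArchSideTerm.muSharp₂₃ @μ))) (EtaChi.hηc (@SInstance.χVR @hGR @hGR₀ @hGR₁) (@SInstance.χWR @hGR @hGR₀ @hGR₁ (ArchSideTerm.muSharp₂₃ @μ))))) (thetaOf _ (thetaClassInputOf _ (fun V c => thetaSpaceInputOf hHD hI h₁ h₃ S V c)))).toCore (orientBitι L ι₁)).side12 (d12Of (ArchSideTerm.muSharp₂₃ @μ))) (((coreOf _ (_root_.HodgeCM.Model.embOf hHD hI h₁ h₃) (coverOf hHD hI h₁ h₃ hA) (wmOfInput (Wcm hGR (EtaChi.η (@SInstance.χVR @hGR @hGR₀ @hGR₁)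 (@SInstance.χWR @hGR @hGR₀ @hGR₁ (ArchSideTerm.muSharp₂₃ @μ))) (EtaChi.hη (@SInstance.χVR @hGR @hGR₀ @hGR₁) (@SInstance.χWR @hGR @hGR₀ @hGR₁ (ArchSideTerm.muSharp₂₃ @μ))) (EtaChi.hηc (@SInstance.χVR @hGR @hGR₀ @hGR₁) (@SInstance.χWR @hGR @hGR₀ @hGR₁ (ArchSideTerm.muSharp₂₃ @μ))))) (thetaOf _ (thetaClassInputOf _ (fun V c => thetaSpaceInputOf hHD hI h₁ h₃ S V c)))).toCore (orientBitι L ι₁)).side34 (d34Of (ArchSideTerm.muSharp₂₃ @μ)))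
      ((((coreOf _ (_root_.HodgeCM.Model.embOf hHD hI h₁ h₃) (coverOf hHD hI h₁ h₃ hA) (wmOfInput (Wcm hGR (EtaChi.η (@SInstance.χVR @hGR @hGR₀ @hGR₁) (@SInstance.χWR @hGR @hGR₀ @hGR₁ (ArchSideTerm.muSharp₂₃ @μ))) (EtaChi.hη (@SInstance.χVR @hGR @hGR₀ @hGR₁) (@SInstance.χWR @hGR @hGR₀ @hGR₁ (ArchSideTerm.muSharp₂₃ @μ))) (EtaChi.hηc (@SInstance.χVR @hGR @hGR₀ @hGR₁) (@SInstance.χWR @hGR @hGR₀ @hGR₁ (ArchSideTerm.muSharp₂₃ @μ))))) (thetaOf _ (thetaClassInputOf _ (fun V c => thetaSpaceInputOf hHD hI h₁ h₃ S V c)))).toCore (orientBitι L ι₁)).analyticKM (((coreOf _ (_root_.HodgeCM.Model.embOf hHD hI h₁ h₃) (coverOf hHD hI h₁ h₃ hA) (wmOfInput (Wcm hGR (EtaChi.η (@SInstance.χVR @hGR @hGR₀ @hGR₁) (@SInstance.χWR @hGR @hGR₀ @hGR₁ (ArchSideTerm.muSharp₂₃ @μ))) (EtaChi.hη (@SInstance.χVR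 @hGR @hGR₀ @hGR₁) (@SInstance.χWR @hGR @hGR₀ @hGR₁ (ArchSideTerm.muSharp₂₃ @μ))) (EtaChi.hηc (@SInstance.χVR @hGR @hGR₀ @hGR₁) (@SInstance.χWR @hGR @hGR₀ @hGR₁ (ArchSideTerm.muSharp₂₃ @μ))))) (thetaOf _ (thetaClassInputOf _ (fun V c => thetaSpaceInputOf hHD hI h₁ h₃ S V c)))).toCore (orientBitι L ι₁)).side12 (d12Of (ArchSideTerm.muSharp₂₃ @μ)))
        (((coreOf _ (_root_.HodgeCM.Model.embOf hHD hI h₁ h₃) (coverOf hHD hI h₁ h₃ hA) (wmOfInput (Wcm hGR (EtaChi.η (@SInstance.χVR @hGR @hGR₀ @hGR₁) (@SInstance.χWR @hGR @hGR₀ @hGR₁ (ArchSideTerm.muSharp₂₃ @μ))) (EtaChi.hη (@SInstance.χVR @hGR @hGR₀ @hGR₁) (@SInstance.χWR @hGR @hGR₀ @hGR₁ (ArchSideTerm.muSharp₂₃ @μ))) (EtaChi.hηc (@SInstance.χVR @hGR @hGR₀ @hGR₁) (@SInstance.χWR @hGR @hGR₀ @hGR₁ (ArchSideTerm.muSharp₂₃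 @μ))))) (thetaOf _ (thetaClassInputOf _ (fun V c => thetaSpaceInputOf hHD hI h₁ h₃ S V c)))).toCore (orientBitι L ι₁)).side34 (d34Of (ArchSideTerm.muSharp₂₃ @μ)))).toAnalytic) V c (ℓ := linOfInput (Wcm hGR (EtaChi.η (@SInstance.χVR @hGR @hGR₀ @hGR₁) (@SInstance.χWR @hGR @hGR₀ @hGR₁ (ArchSideTerm.muSharp₂₃ @μ))) (EtaChi.hη (@SInstance.χVR @hGR @hGR₀ @hGR₁) (@SInstance.χWR @hGR @hGR₀ @hGR₁ (ArchSideTerm.muSharp₂₃ @μ))) (EtaChi.hηc (@SInstance.χVR @hGR @hGR₀ @hGR₁) (@SInstance.χWR @hGR @hGR₀ @hGR₁ (ArchSideTerm.muSharp₂₃ @μ)))) V c)) :=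
  have hc' : SignRecipe.GoodCtx (orientBitι L ι₁) ι₁ c :=
    ((cpinC hHD hI h₁ h₃ hA (Wcm hGR (EtaChi.η (@SInstance.χVR @hGR @hGR₀ @hGR₁) (@SInstance.χWR @hGR @hGR₀ @hGR₁ (ArchSideTerm.muSharp₂₃ @μ))) (EtaChi.hη (@SInstance.χVR @hGR @hGR₀ @hGR₁) (@SInstance.χWR @hGR @hGR₀ @hGR₁ (ArchSideTerm.muSharp₂₃ @μ))) (EtaChi.hηc (@SInstance.χVR @hGR @hGR₀ @hGR₁) (@SInstance.χWR @hGR @hGR₀ @hGR₁ (ArchSideTerm.muSharp₂₃ @μ)))) S).thetaModel_goodCtx_iff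
      (orientBitι L ι₁) (d12Of (ArchSideTerm.muSharp₂₃ @μ)) (d34Of (ArchSideTerm.muSharp₂₃ @μ)) ι₁ c).mp hc
  hyp12_of_census_R1At_of_hμ hHD hI h₁ h₃ hA hGR hGR₀ hGR₁ (@SInstance.χWR @hGR @hGR₀ @hGR₁ (ArchSideTerm.muSharp₂₃ @μ)) S (ArchSideTerm.muSharp₂₃ @μ) V c hc hK hcan jD
    fun hW t => ArchSideTerm.hμ_GOG hGR (@SInstance.χVR @hGR @hGR₀ @hGR₁) hGR₀ hGR₁ hGR₂ hGR₃ μ V c ⟨hcan, hc'⟩ hW _ t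

end GOG

end HodgeCM.Model.HypCensus

end
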